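import Summits.QuantumFields.YangMills.Theorems.BalabanUVNodesN15UnitLayerBgExactDressing
import Summits.QuantumFields.YangMills.Theorems.BalabanUVNodesN15GenuineSiteKernelRate

/-!
# Route «BalabanUVNodes», cluster K4 «SpineRates» — node N15 = NE2: THE SITE LAYER WITH THE BACKGROUND LIVE IN THE TwoGrid ENTRY CURRENCY, I — the perturbed-form engine
# (a coercive decaying form plus a small decaying perturbation: decay of the inverse, two-form η-rate) and the LETTER BLOCK of the genuine `U ≡ 1` site form `Q′G′²Q′*`

Cell `pub-ymgap`, WIDTH SEAT `pub-ymgap-dag-n15-w1` (generation 0; director-ym №197 ∕ HUMAN RULING D-0149; chair R455 (A) ∕ R461; plan g77 `W-SEAT-START-LIST.md` §2 n15 ITEM 1 «the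
three layers read BY NAME … the KNIT», taken as: the SITE-LAYER SOCKET + the all-layers-U-seeing knit — bus CLAIM pub-ymgap INBOX l.24149).  `bears_on: R4∕N15 · K3⁷
SpineGivenEndpointR13SepCoPH (stmt-QuantumFields-20544)`.  Filed `--kind proof --supports stmt-QuantumFields-20544 --as helper` — COUNT-NEUTRAL.  THEOREMS ONLY (0 `def`, 0 `sorry`).
Imports dag-n15-a V-B `…N15UnitLayerBgExactDressing` (finite Combes–Thomas in entry currency `abs_inv_le_of_coercive_decay`, `coercive_add_of_decay`, `inv_sub_inv_eq`, the letter
monotonicities) and dag-n15-c G1 `…N15GenuineSiteKernelRate` (`decays_tdist`, `gram_rate_family`; through it dag-n15-a part 49 `gram_entry_eq_blocks`, b04∕b05 `KRe`, `qggqRe`,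
`coercive_qggqRe`); nothing in the tree is modified.

WHY.  dag-n15-a V-F (`…N15FullPropagatorExactUnitSocket`, p581133) knits `N15At` on any family `pi i = ⟨tgGeoC (ι i), gf i, Bc i, Bf i, pair i⟩` from an operator layer BY NAME and the
EXACTLY DRESSED U-seeing (2.156) unit layer; its SITE layer is still part 78's `tgSiteOn` — dag-n15-c G1's genuine `U ≡ 1` kernel `(Q′G′²Q′*)⁻¹′ − (Q′G′²Q′*)⁻¹` RE-BASED, the
configuration DROPPED (HANDOFF-dag-n15-a §g16.4 (a): «the SITE layer with the background live … NOT touched»; ref-B's standing finding «site ∕ unit layers U-blind by construction»,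
unit half answered by U-D∕V-D).  The print dresses the site form by a small decaying perturbation and inverts by perturbation ([Balaban1985BackgroundPropagators] p. 403:
«Q′(U′U)G′²(U′U)Q′*(U′U) = Q′(U)G′²(U)Q′*(U) + C(A) (3.65) … |C(A; y, y′)| ≦ O(1)α₁…e^{−(1∕2)δ₀d(y,y′)} (3.66) … an inverse of the left-hand side can be expressed by a Neumann
series convergent for α₁ sufficiently small (3.67)»).  THIS FILE is the species-independent ENGINE of that step in V-F's entry currency (matrices on the coarse index `Idx M` of the
unit torus, King's `tdist`), with COERCIVITY + finite Combes–Thomas in place of the Neumann series (as V-B does for the unit layer), and the LETTER BLOCK of the `U ≡ 1` form it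
perturbs; the sequel `…N15FullPropagatorExactSiteSocket` builds the socket kernel and the knit.

CONTENTS.
* §1 ENGINE (generic finite index `ι`, pseudo-metric `ρ`; [folklore]): `abs_add_le_of_letters`; ★ `abs_inv_add_le_of_coercive` — `K` `γ`-coercive with `|K| ≤ c₀e^{−κρ}`,
  `|P| ≤ ζe^{−κρ}`, row sum `V₁` at `κ∕4`, `ζV₁ ≤ γ∕2`, `8(c₀ + ζ)V₁κ₁ ≤ γκ` ⟹ `K + P` is `(γ − ζV₁)`-coercive and `|(K + P)⁻¹| ≤ (4∕γ)e^{−κ₁ρ}`; ★★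
  `abs_inv_add_sub_inv_add_le_of_coercive` — two such pairs with `|K′ − K| ≤ θe^{−κρ}`, `|P′ − P| ≤ τe^{−κρ}`, row sum `V₂` at `κ₁∕2` ⟹
  `|(K′ + P′)⁻¹ − (K + P)⁻¹| ≤ (4∕γ)(θ + τ)(4∕γ)V₂²·e^{−(κ₁∕2)ρ}` (second resolvent identity + King's `triple_decay_bound`).
* §2 THE GENUINE SITE FORM's LETTERS at King's couplings `a_j` on the unit tori: `qggqRe_decay_family` (`|Q′G′²Q′*_{n,a_j}(k₁,k₂)| ≤ C·e^{−δ·tdist}`, every grid, every torus — the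
  Gram entry regrouped by unit blocks, b04's decay of `K_T = G′Q′*`, `n^{d+1}` points per block, `conv_decay`); ★ `siteForm_letters_family` — on the tori of record `M_μ = 2L^{m_T}`,
  ONE `(γ₀, c₀, δ, C_r)`: coarse `N_{L^k,a_k}` and fine `N_{L^mL^k,a_{k+m}}` are `γ₀`-coercive (b05 `coercive_qggqRe`), decay `≤ c₀e^{−δ·tdist}`, differ by
  `≤ C_r(L^k)^{−¼}e^{−δ·tdist}` (G1 `gram_rate_family` at `γ = ½`).

HONEST FRAMING.  Finite-dimensional linear algebra + the lineage's theorems BY NAME; §2 is [B5]'s SCALAR `Q′, G′ = (Δ′ + aQ′*Q′)⁻¹` at `U ≡ 1` with King's running couplings on the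
finite unit tori `2L^{m_T}` — MODEL level (the `A = 0` object inside [B9] Thm 3.2's kernel); no perturbation is constructed here (the sequel's socket takes its letters as
HYPOTHESES).  NOT [B9] Thm 3.2 at a general (3.35)-regular `U` (NE2⁺ NOT PRINTED as an η-rate); Node 00's [B9] layers of record are residual — **N15 is NOT discharged** (typed
28∕28 · discharged 5∕27 of record unchanged); one finite four-torus programme at fixed `ε` — NOT ℝ⁴, NOT infinite volume, NOT OS, NOT a mass gap, NOT Clay; R4 closes the
conditional finite-𝕋⁴ rung `BalabanLadder.UV` only.  Restate-immune (no Theses import).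
-/

set_option autoImplicit false

noncomputable section

open scoped BigOperators Matrix
open Finset

namespace Summit.QuantumFields.YangMills.BalabanUVNodes.N15.SiteLayerBg

open Literature.MathematicalPhysics.QuantumFieldTheory.Balaban1983to89
open Literature.MathematicalPhysics.QuantumFieldTheory.Balaban1983to89.QGQInverse (Coercive isUnit_of_coercive)
open Literature.MathematicalPhysics.QuantumFieldTheory.King1986 (triple_decay_bound exp_decay_mono)
open Summit.QuantumFields.YangMills.BalabanUVNodes.N15.UnitLayerBg (abs_inv_le_of_coercive_decay coercive_add_of_decay inv_sub_inv_eq entry_mono rowSum_mono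
  one_le_of_rowSum)

/-! ## §1 The engine: the inverse of a coercive decaying form under a small decaying perturbation — decay and two-form rate -/

section Engine

variable {ι : Type} [Fintype ι] [DecidableEq ι] (ρ : ι → ι → ℝ)

omit [Fintype ι] [DecidableEq ι] in
/-- entries of a sum of two matrices with entry letters at one rate: `|K + P| ≤ (c₀ + ζ)e^{−κρ}`. [folklore] -/
theorem abs_add_le_of_letters {K P : Matrix ι ι ℝ} {c₀ ζ κ : ℝ} (hK : ∀ p q, |K p q| ≤ c₀ * Real.exp (-(κ * ρ p q)))
    (hP : ∀ p q, |P p q| ≤ ζ * Real.exp (-(κ * ρ p q))) (p q : ι) : |(K + P) p q| ≤ (c₀ + ζ) * Real.exp (-(κ * ρ p q)) := by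
  rw [Matrix.add_apply, add_mul]
  exact (abs_add_le _ _).trans (add_le_add (hK p q) (hP p q))

/-- ★ **THE PERTURBED FORM IS COERCIVE AND ITS INVERSE DECAYS.**  `K` `γ`-coercive (`γ > 0`) with `|K| ≤ c₀e^{−κρ}` (`κ > 0`), a perturbation `|P| ≤ ζe^{−κρ}`, a rate
`0 ≤ κ₁ ≤ κ∕4`, the row sum `Σ_q e^{−(κ∕4)ρ} ≤ V₁`, the coercivity smallness `ζV₁ ≤ γ∕2` and the Combes–Thomas smallness `8(c₀ + ζ)V₁κ₁ ≤ γκ` ⟹ `K + P` is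
`(γ − ζV₁)`-coercive (`≥ γ∕2`) and `|(K + P)⁻¹(p,q)| ≤ (4∕γ)e^{−κ₁ρ(p,q)}` (V-B's `coercive_add_of_decay` + finite Combes–Thomas `abs_inv_le_of_coercive_decay`).
[cite: CombesThomas1973, §II (mechanism); Balaban1985BackgroundPropagators, (3.66)–(3.67) p.403 (shape: a small decaying perturbation of the site form)] [folklore] -/
theorem abs_inv_add_le_of_coercive (hρ : ∀ p q, 0 ≤ ρ p q) (hρs : ∀ p q, ρ p q = ρ q p) (hρ0 : ∀ p, ρ p p = 0) (hρt : ∀ p q r, ρ p r ≤ ρ p q + ρ q r)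
    {K P : Matrix ι ι ℝ} {γ c₀ ζ κ κ₁ V₁ : ℝ} (hγ : 0 < γ) (hc₀ : 0 ≤ c₀) (hζ : 0 ≤ ζ) (hκ : 0 < κ) (hκ₁ : 0 ≤ κ₁) (hκ₁κ : κ₁ ≤ κ / 4)
    (hco : Coercive K γ) (hK : ∀ p q, |K p q| ≤ c₀ * Real.exp (-(κ * ρ p q))) (hP : ∀ p q, |P p q| ≤ ζ * Real.exp (-(κ * ρ p q)))
    (hV₁ : ∀ p, ∑ q, Real.exp (-(κ / 4 * ρ p q)) ≤ V₁) (hs₁ : ζ * V₁ ≤ γ / 2) (hs₂ : 8 * (c₀ + ζ) * V₁ * κ₁ ≤ γ * κ) :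
    Coercive (K + P) (γ - ζ * V₁) ∧ ∀ p q : ι, |(K + P)⁻¹ p q| ≤ 4 / γ * Real.exp (-(κ₁ * ρ p q)) := by
  rcases isEmpty_or_nonempty ι with hι | hι
  · exact ⟨fun x => by simp [dotProduct], fun p => isEmptyElim p⟩
  have hV₁1 : 1 ≤ V₁ := one_le_of_rowSum ρ hρ0 hV₁ (Classical.arbitrary ι)
  have hV₁0 : 0 ≤ V₁ := by linarith
  -- coercivity of `K + P`
  have hVκ : ∀ p, ∑ q, Real.exp (-(κ * ρ p q)) ≤ V₁ := rowSum_mono ρ hρ (by linarith) hV₁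
  have hcoA : Coercive (K + P) (γ - ζ * V₁) := coercive_add_of_decay ρ hρs hco hζ hV₁0 hP hVκ
  refine ⟨hcoA, fun p q => ?_⟩
  -- Combes–Thomas for `A = K + P` at rate `κ`, target `κ₁`, margin `κ/2`
  have hA : ∀ p q, |(K + P) p q| ≤ (c₀ + ζ) * Real.exp (-(κ * ρ p q)) := abs_add_le_of_letters ρ hK hP
  have hV : ∀ p, ∑ q, Real.exp (-((κ - κ₁ - κ / 2) * ρ p q)) ≤ V₁ := rowSum_mono ρ hρ (by linarith) hV₁
  have hC : 0 ≤ c₀ + ζ := by positivity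
  have hρw : (c₀ + ζ) * V₁ * κ₁ / (κ / 2) ≤ γ / 4 := by
    rw [div_le_iff₀ (by positivity)]
    nlinarith
  have hsmall : (c₀ + ζ) * V₁ * κ₁ / (κ / 2) < γ - ζ * V₁ := by linarith
  have h := abs_inv_le_of_coercive_decay ρ hρ hρs hρ0 hρt _ hcoA hC hκ₁ (half_pos hκ) hA hV hsmall p q
  refine h.trans (mul_le_mul_of_nonneg_right ?_ (Real.exp_pos _).le)
  rw [show (4 : ℝ) / γ = (γ / 4)⁻¹ by rw [inv_div]]
  exact inv_anti₀ (by positivity) (by linarith)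

/-- ★★ **THE TWO-FORM RATE OF THE PERTURBED INVERSES.**  Two forms `K, K′` and two perturbations `P, P′` with the letters of `abs_inv_add_le_of_coercive` (same constants),
the differences `|K′ − K| ≤ θe^{−κρ}`, `|P′ − P| ≤ τe^{−κρ}` and the row sum `Σ_q e^{−(κ₁∕2)ρ} ≤ V₂` ⟹
`|(K′ + P′)⁻¹(p,q) − (K + P)⁻¹(p,q)| ≤ (4∕γ)·(θ + τ)·(4∕γ)·V₂²·e^{−(κ₁∕2)ρ(p,q)}` — the second resolvent identity `D′ − D = D′·((K + P) − (K′ + P′))·D` (V-B `inv_sub_inv_eq`) and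
King's `triple_decay_bound`. [cite: King1986, (4.40)–(4.41) pp.674–675 (mechanism); Balaban1984PropagatorsI, (1.45) p.26 (the resolvent identity for the site form)] [folklore] -/
theorem abs_inv_add_sub_inv_add_le_of_coercive (hρ : ∀ p q, 0 ≤ ρ p q) (hρs : ∀ p q, ρ p q = ρ q p) (hρ0 : ∀ p, ρ p p = 0)
    (hρt : ∀ p q r, ρ p r ≤ ρ p q + ρ q r)
    {K K' P P' : Matrix ι ι ℝ} {γ c₀ ζ θ τ κ κ₁ V₁ V₂ : ℝ} (hγ : 0 < γ) (hc₀ : 0 ≤ c₀) (hζ : 0 ≤ ζ) (hθ : 0 ≤ θ) (hτ : 0 ≤ τ) (hκ : 0 < κ) (hκ₁ : 0 ≤ κ₁)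
    (hκ₁κ : κ₁ ≤ κ / 4)
    (hco : Coercive K γ) (hco' : Coercive K' γ) (hK : ∀ p q, |K p q| ≤ c₀ * Real.exp (-(κ * ρ p q))) (hK' : ∀ p q, |K' p q| ≤ c₀ * Real.exp (-(κ * ρ p q)))
    (hP : ∀ p q, |P p q| ≤ ζ * Real.exp (-(κ * ρ p q))) (hP' : ∀ p q, |P' p q| ≤ ζ * Real.exp (-(κ * ρ p q)))
    (hKK : ∀ p q, |K' p q - K p q| ≤ θ * Real.exp (-(κ * ρ p q))) (hPP : ∀ p q, |P' p q - P p q| ≤ τ * Real.exp (-(κ * ρ p q)))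
    (hV₁ : ∀ p, ∑ q, Real.exp (-(κ / 4 * ρ p q)) ≤ V₁) (hV₂ : ∀ p, ∑ q, Real.exp (-(κ₁ / 2 * ρ p q)) ≤ V₂) (hs₁ : ζ * V₁ ≤ γ / 2)
    (hs₂ : 8 * (c₀ + ζ) * V₁ * κ₁ ≤ γ * κ) (p q : ι) :
    |(K' + P')⁻¹ p q - (K + P)⁻¹ p q| ≤ 4 / γ * (θ + τ) * (4 / γ) * V₂ ^ 2 * Real.exp (-(κ₁ / 2 * ρ p q)) := by
  rcases isEmpty_or_nonempty ι with hι | hι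
  · exact isEmptyElim p
  have hV₁1 : 1 ≤ V₁ := one_le_of_rowSum ρ hρ0 hV₁ p
  obtain ⟨hcoA, hD⟩ := abs_inv_add_le_of_coercive ρ hρ hρs hρ0 hρt hγ hc₀ hζ hκ hκ₁ hκ₁κ hco hK hP hV₁ hs₁ hs₂
  obtain ⟨hcoA', hD'⟩ := abs_inv_add_le_of_coercive ρ hρ hρs hρ0 hρt hγ hc₀ hζ hκ hκ₁ hκ₁κ hco' hK' hP' hV₁ hs₁ hs₂
  have hγA : 0 < γ - ζ * V₁ := by linarith
  have hU : IsUnit (K + P).det := (Matrix.isUnit_iff_isUnit_det _).mp (isUnit_of_coercive hγA hcoA)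
  have hU' : IsUnit (K' + P').det := (Matrix.isUnit_iff_isUnit_det _).mp (isUnit_of_coercive hγA hcoA')
  have e := congrArg (fun N : Matrix ι ι ℝ => N p q) (inv_sub_inv_eq (Matrix.nonsing_inv_mul _ hU') (Matrix.mul_nonsing_inv _ hU))
  simp only [Matrix.sub_apply] at e
  rw [e]
  -- the middle factor `(K + P) − (K′ + P′)` at rate `κ₁`
  have hE₀ : ∀ p q, |((K + P) - (K' + P')) p q| ≤ (θ + τ) * Real.exp (-(κ * ρ p q)) := fun p q => by
    rw [Matrix.sub_apply, Matrix.add_apply, Matrix.add_apply, abs_sub_comm,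
      show K' p q + P' p q - (K p q + P p q) = (K' p q - K p q) + (P' p q - P p q) by ring, add_mul]
    exact (abs_add_le _ _).trans (add_le_add (hKK p q) (hPP p q))
  have hE : ∀ p q, |((K + P) - (K' + P')) p q| ≤ (θ + τ) * Real.exp (-(κ₁ * ρ p q)) :=
    entry_mono ρ hρ (by positivity) (show κ₁ ≤ κ by linarith) hE₀
  exact triple_decay_bound ρ hρ hρt _ _ _ hκ₁ (by positivity : (0:ℝ) ≤ 4 / γ) (by positivity : (0:ℝ) ≤ θ + τ) hD' hE hD hV₂ p q

end Engine

/-! ## §2 The genuine `U ≡ 1` site form `Q′G′²Q′*` at King's couplings on the tori of record: decay, coercivity, two-grid defect — ONE letter block -/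

section Family

open Literature.MathematicalPhysics.QuantumFieldTheory.Balaban1983to89.B5Prop11Plancherel (Tor fine)
open Literature.MathematicalPhysics.QuantumFieldTheory.Balaban1983to89.B4Sect5Torus (tdist tdist_nonneg tdist_symm tdist_triangle tdist_self torusSum_le)
open Literature.MathematicalPhysics.QuantumFieldTheory.Balaban1983to89.B4Sect5Proof (latticeConst latticeConst_nonneg)
open Literature.MathematicalPhysics.QuantumFieldTheory.Balaban1983to89.B5QGGQ145Bounds (Idx kerRe qggqRe coercive_qggqRe qggqRe_inv)
open Literature.MathematicalPhysics.QuantumFieldTheory.Balaban1983to89.B5QGGQ145Factor (KRe)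
open Literature.MathematicalPhysics.QuantumFieldTheory.Balaban1983to89.B5DPD126Uniform (cIdx conv_decay)
open Literature.MathematicalPhysics.QuantumFieldTheory.Balaban1983to89.B5PBridgeProjection (torIdx)
open Literature.MathematicalPhysics.QuantumFieldTheory.Balaban1983to89.T4EtaRateCoeffDefect (fibre mem_fibre)
open Literature.MathematicalPhysics.QuantumFieldTheory.King1986 (aK aK_pos)
open Literature.MathematicalPhysics.QuantumFieldTheory.King1986.Torus (blockOf aminL aminL_pos aminL_le_aK)
open Literature.MathematicalPhysics.QuantumFieldTheory.Balaban1983to89.B6UnitTorusCarrier (card_fibre_blockOf)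
open Summit.QuantumFields.YangMills.BalabanUVNodes.N15.GenuineSite (decays_tdist gram_rate_family)
open Summit.QuantumFields.YangMills.BalabanUVNodes.N15.TwoGrid (gram_entry_eq_blocks cIdx_torIdx)

variable {d : ℕ} {L : ℕ} [NeZero L]

omit [NeZero L] in
/-- **THE DECAY OF THE GENUINE `U ≡ 1` SITE FORM `N = Q′G′²Q′*` AT KING's COUPLINGS, EVERY TORUS, EVERY GRID**: for `L ≥ 2`, `a > 0` there are `δ, C > 0` with
`|Q′G′²Q′*_{n, a_j}(k₁,k₂)| ≤ C·e^{−δ·tdist(k₁,k₂)}` for every `j ≥ 1`, grid `n ≥ 1` and unit torus — the Gram entry `N(k,k′) = Σ_b η^{d+1}Σ_{x ∈ B(b)} K_T(x,k)K_T(x,k′)` (dag-n15-a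
part 49 `gram_entry_eq_blocks`) with b04's decay of `K_T = G′Q′*` (`decays_tdist`) and `n^{d+1}` points per unit block (`card_fibre_blockOf`), summed by `conv_decay`.
[cite: Balaban1984PropagatorsI, p.25 (the Gram form), (1.45) p.26, Prop. 1.2 (1.110) p.35; King1986, (2.13) p.653 (the couplings)] -/
theorem qggqRe_decay_family (hL2 : 2 ≤ L) {a : ℝ} (ha : 0 < a) :
    ∃ δ C : ℝ, 0 < δ ∧ 0 < C ∧ ∀ (j : ℕ) (_hj : 1 ≤ j) (n : ℕ) [NeZero n] (M : Fin (d + 1) → ℕ) [∀ μ, NeZero (M μ)] (k₁ k₂ : Idx M),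
      |qggqRe n (aK a L j) M k₁ k₂| ≤ C * Real.exp (-(δ * tdist M k₁ k₂)) := by
  have hamin := aminL_pos ha hL2
  obtain ⟨δ₀, CK, CI, hδ₀, hCK, _hCI, HK, _HI⟩ := decays_tdist (d := d) (aplus := a) hamin
  have hK2 : 0 ≤ latticeConst (d + 1) (δ₀ / 2) := latticeConst_nonneg _ (by positivity)
  refine ⟨δ₀ / 2, CK * CK * latticeConst (d + 1) (δ₀ / 2) + 1, by positivity, by positivity, fun j hj n _ M _ k₁ k₂ => ?_⟩
  classical
  have hM1 : ∀ i, 1 ≤ M i := fun i => Nat.one_le_iff_ne_zero.mpr (NeZero.ne (M i))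
  have hLr : (1 : ℝ) < L := by exact_mod_cast (show 1 < L by omega)
  have haj := aminL_le_aK ha hL2 hj
  have haK : 0 < aK a L j := aK_pos ha hLr hj
  have hn0 : ((n : ℝ) ^ (d + 1)) ≠ 0 := pow_ne_zero _ (Nat.cast_ne_zero.mpr (NeZero.ne n))
  rw [gram_entry_eq_blocks M n haK k₁ k₂]
  -- one unit block: `n^{d+1}` points, each term bounded by the two decays at the block's label
  have hblk : ∀ b : Tor M, |((n : ℝ) ^ (d + 1))⁻¹ * ∑ x ∈ fibre (blockOf n M) b, KRe n (aK a L j) M (torIdx (fine n M) x) k₁ * KRe n (aK a L j) M (torIdx (fine n M) x) k₂|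
      ≤ CK * Real.exp (-(δ₀ * tdist M (torIdx M b) k₁)) * (CK * Real.exp (-(δ₀ * tdist M (torIdx M b) k₂))) := by
    intro b
    have hterm : ∀ x ∈ fibre (blockOf n M) b, |KRe n (aK a L j) M (torIdx (fine n M) x) k₁ * KRe n (aK a L j) M (torIdx (fine n M) x) k₂|
        ≤ CK * Real.exp (-(δ₀ * tdist M (torIdx M b) k₁)) * (CK * Real.exp (-(δ₀ * tdist M (torIdx M b) k₂))) := by
      intro x hx
      have hbx : blockOf n M x = b := (mem_fibre _ _ _).mp hx
      have hc : cIdx n M (torIdx (fine n M) x) = torIdx M b := by rw [cIdx_torIdx, hbx]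
      have h1 := HK n (aK a L j) haj.1 haj.2 M hM1 (torIdx (fine n M) x) k₁
      have h2 := HK n (aK a L j) haj.1 haj.2 M hM1 (torIdx (fine n M) x) k₂
      rw [hc] at h1 h2
      rw [abs_mul]
      exact mul_le_mul h1 h2 (abs_nonneg _) (by positivity)
    rw [abs_mul, abs_of_nonneg (by positivity : (0 : ℝ) ≤ ((n : ℝ) ^ (d + 1))⁻¹)]
    calc ((n : ℝ) ^ (d + 1))⁻¹ * |∑ x ∈ fibre (blockOf n M) b, KRe n (aK a L j) M (torIdx (fine n M) x) k₁ * KRe n (aK a L j) M (torIdx (fine n M) x) k₂|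
        ≤ ((n : ℝ) ^ (d + 1))⁻¹ * ∑ x ∈ fibre (blockOf n M) b, |KRe n (aK a L j) M (torIdx (fine n M) x) k₁ * KRe n (aK a L j) M (torIdx (fine n M) x) k₂| :=
          mul_le_mul_of_nonneg_left (abs_sum_le_sum_abs _ _) (by positivity)
      _ ≤ ((n : ℝ) ^ (d + 1))⁻¹ * ∑ _x ∈ fibre (blockOf n M) b, CK * Real.exp (-(δ₀ * tdist M (torIdx M b) k₁)) * (CK * Real.exp (-(δ₀ * tdist M (torIdx M b) k₂))) :=
          mul_le_mul_of_nonneg_left (sum_le_sum hterm) (by positivity)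
      _ = CK * Real.exp (-(δ₀ * tdist M (torIdx M b) k₁)) * (CK * Real.exp (-(δ₀ * tdist M (torIdx M b) k₂))) := by
          rw [sum_const, nsmul_eq_mul, card_fibre_blockOf, Nat.cast_pow, ← mul_assoc, inv_mul_cancel₀ hn0, one_mul]
  -- sum over the blocks = sum over the coarse index, then the lattice convolution
  have hsum : ∑ b : Tor M, CK * Real.exp (-(δ₀ * tdist M (torIdx M b) k₁)) * (CK * Real.exp (-(δ₀ * tdist M (torIdx M b) k₂)))
      = ∑ c : Idx M, CK * Real.exp (-(δ₀ * tdist M k₁ c)) * (CK * Real.exp (-(δ₀ * tdist M c k₂))) := by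
    rw [← (torIdx M).sum_comp (fun c : Idx M => CK * Real.exp (-(δ₀ * tdist M k₁ c)) * (CK * Real.exp (-(δ₀ * tdist M c k₂))))]
    exact sum_congr rfl fun b _ => by rw [tdist_symm hM1 (torIdx M b) k₁]
  have hconv := conv_decay hM1 hδ₀ (fun c => CK * Real.exp (-(δ₀ * tdist M k₁ c))) (fun c => CK * Real.exp (-(δ₀ * tdist M c k₂))) k₁ k₂
    (fun c => by rw [abs_of_nonneg (by positivity)]) (fun c => by rw [abs_of_nonneg (by positivity)])
  calc |∑ b : Tor M, ((n : ℝ) ^ (d + 1))⁻¹ * ∑ x ∈ fibre (blockOf n M) b, KRe n (aK a L j) M (torIdx (fine n M) x) k₁ * KRe n (aK a L j) M (torIdx (fine n M) x) k₂|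
      ≤ ∑ b : Tor M, |((n : ℝ) ^ (d + 1))⁻¹ * ∑ x ∈ fibre (blockOf n M) b, KRe n (aK a L j) M (torIdx (fine n M) x) k₁ * KRe n (aK a L j) M (torIdx (fine n M) x) k₂| :=
        abs_sum_le_sum_abs _ _
    _ ≤ ∑ b : Tor M, CK * Real.exp (-(δ₀ * tdist M (torIdx M b) k₁)) * (CK * Real.exp (-(δ₀ * tdist M (torIdx M b) k₂))) := sum_le_sum fun b _ => hblk b
    _ = ∑ c : Idx M, CK * Real.exp (-(δ₀ * tdist M k₁ c)) * (CK * Real.exp (-(δ₀ * tdist M c k₂))) := hsum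
    _ ≤ CK * CK * latticeConst (d + 1) (δ₀ / 2) * Real.exp (-(δ₀ / 2 * tdist M k₁ k₂)) := (le_abs_self _).trans hconv
    _ ≤ (CK * CK * latticeConst (d + 1) (δ₀ / 2) + 1) * Real.exp (-(δ₀ / 2 * tdist M k₁ k₂)) := mul_le_mul_of_nonneg_right (by linarith) (Real.exp_nonneg _)

/-- ★ **THE LETTER BLOCK OF THE GENUINE SITE FORM ON THE TORUS FAMILY OF RECORD** (odd `L ≥ 3`, `a > 0`): ONE `(γ₀, c₀, δ, C_r)` such that for every torus exponent `m_T`, coarse scale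
`k ≥ 1`, refinement `m` and every unit torus `M_μ = 2L^{m_T}`: the coarse form `N_{L^k, a_k}` and the fine form `N_{L^m·L^k, a_{k+m}}` are `γ₀`-COERCIVE (b05 `coercive_qggqRe` on the window
`[a(1 − L⁻²), a]` of King's couplings), DECAY `≤ c₀e^{−δ·tdist}` (`qggqRe_decay_family`), and differ by `≤ C_r·(L^k)^{−¼}·e^{−δ·tdist}` (dag-n15-c G1 `gram_rate_family` at `γ = ½`).
[cite: Balaban1984PropagatorsI, p.26 (the sentence after (1.45): the operator window), p.25; King1986, Prop. 3.8 (3.71) p.664 (rate shape), (2.13) p.653] -/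
theorem siteForm_letters_family (hLodd : Odd L) (hL2 : 2 ≤ L) {a : ℝ} (ha : 0 < a) :
    ∃ γ₀ c₀ δ Cr : ℝ, 0 < γ₀ ∧ 0 < c₀ ∧ 0 < δ ∧ 0 < Cr ∧
      ∀ (mT k m : ℕ) (_hk : 1 ≤ k) (M : Fin (d + 1) → ℕ) [∀ μ, NeZero (M μ)] (_hM : ∀ μ, M μ = 2 * L ^ mT),
        Coercive (qggqRe (L ^ k) (aK a L k) M) γ₀ ∧ Coercive (qggqRe (L ^ m * L ^ k) (aK a L (k + m)) M) γ₀ ∧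
        (∀ k₁ k₂ : Idx M, |qggqRe (L ^ k) (aK a L k) M k₁ k₂| ≤ c₀ * Real.exp (-(δ * tdist M k₁ k₂))) ∧
        (∀ k₁ k₂ : Idx M, |qggqRe (L ^ m * L ^ k) (aK a L (k + m)) M k₁ k₂| ≤ c₀ * Real.exp (-(δ * tdist M k₁ k₂))) ∧
        (∀ k₁ k₂ : Idx M, |qggqRe (L ^ m * L ^ k) (aK a L (k + m)) M k₁ k₂ - qggqRe (L ^ k) (aK a L k) M k₁ k₂|
          ≤ Cr * ((L : ℝ) ^ k) ^ (-(1 / 4 : ℝ)) * Real.exp (-(δ * tdist M k₁ k₂))) := by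
  have hamin := aminL_pos ha hL2
  obtain ⟨γ₀, hγ₀, Hco⟩ := coercive_qggqRe d (aminL a L) a hamin
  obtain ⟨δ₁, C₁, hδ₁, hC₁, Hdec⟩ := qggqRe_decay_family (d := d) hL2 ha
  obtain ⟨δ₂, C₂, hδ₂, hC₂, Hrate⟩ := gram_rate_family (d := d) hLodd hL2 ha (γ := 1 / 2) (by norm_num) (by norm_num)
  refine ⟨γ₀, C₁, min δ₁ δ₂, C₂, hγ₀, hC₁, lt_min hδ₁ hδ₂, hC₂, fun mT k m hk M _ hM => ?_⟩
  have hM1 : ∀ i, 1 ≤ M i := fun i => Nat.one_le_iff_ne_zero.mpr (NeZero.ne (M i))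
  have hL0 : 0 < L := by omega
  have hak := aminL_le_aK ha hL2 hk
  have hakm := aminL_le_aK ha hL2 (show 1 ≤ k + m by omega)
  have hLk : 1 ≤ L ^ k := Nat.one_le_pow _ _ hL0
  have hLmk : 1 ≤ L ^ m * L ^ k := Nat.one_le_iff_ne_zero.mpr (Nat.mul_ne_zero (by have := Nat.one_le_pow m L hL0; omega) (by omega))
  have hmin1 : min δ₁ δ₂ ≤ δ₁ := min_le_left _ _
  have hmin2 : min δ₁ δ₂ ≤ δ₂ := min_le_right _ _
  have hdec : ∀ (n : ℕ) [NeZero n] (j : ℕ), 1 ≤ j → ∀ k₁ k₂ : Idx M, |qggqRe n (aK a L j) M k₁ k₂| ≤ C₁ * Real.exp (-(min δ₁ δ₂ * tdist M k₁ k₂)) :=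
    fun n _ j hj k₁ k₂ => (Hdec j hj n M k₁ k₂).trans (exp_decay_mono hC₁.le hmin1 (tdist_nonneg M k₁ k₂))
  refine ⟨Hco (L ^ k) hLk _ hak.1 hak.2 M hM1, Hco (L ^ m * L ^ k) hLmk _ hakm.1 hakm.2 M hM1, hdec (L ^ k) k hk, hdec (L ^ m * L ^ k) (k + m) (by omega),
    fun k₁ k₂ => ?_⟩
  have h := Hrate mT k m hk M hM k₁ k₂
  have hcast : ((L ^ k : ℕ) : ℝ) = (L : ℝ) ^ k := by push_cast; ring
  have hq : (-((1 : ℝ) / 2 / 2)) = -(1 / 4) := by norm_num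
  rw [hcast, hq] at h
  have hr : 0 ≤ C₂ * ((L : ℝ) ^ k) ^ (-(1 / 4 : ℝ)) := mul_nonneg hC₂.le (Real.rpow_nonneg (pow_nonneg (Nat.cast_nonneg _) _) _)
  exact h.trans (exp_decay_mono hr hmin2 (tdist_nonneg M k₁ k₂))

end Family

end Summit.QuantumFields.YangMills.BalabanUVNodes.N15.SiteLayerBg

end
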